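import Summits.Schanuel.Schanuel.Theorems.RootDecomp1HClearance

/-!
# RootDecomp1HPin — the HULL PIN at rank three, hypothesis-free, and the Σ-cell discharge readings

Lineage `decomp-schanuel-lens-5`, generation 15 («ADAPTED»).  Routes `route-Schanuel-RootDecomp1H` (DRAFT rev 18) and
`route-Schanuel-RootDecomp1HSigma` (rev 0) are NOT touched: this file proves tools the census port and the Σ-cell coverage
ledger use, about the landed notions `CounterEx`, `InTowerHull`, `TowerTuple` (all `RootDecomp1HClearance` /
`RootDecomp1HCurveHull`).

## 1. The hull pin (rank 3, NO lower-rank hypothesis)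

`inTowerHull_of_depthOne_mem_span` : if `y : Fin 3 → ℂ` is a counterexample (`ℚ`-free, `trdeg ℚ(y, eʸ) < 3`) and its
`ℚ`-span contains a non-zero DEPTH-ONE element `z` (`trdeg ℚ(z, eᶻ) ≤ 1`: `z ∈ iπℚ`, `z = log α`, a Khovanskii single
`a z + b eᶻ + c = 0`, a Kepler coordinate …) then `y` lies IN THE TOWER HULL.  The tree's `not_depthOne_of_mem_span_rank_three`
needs `LowerRanks 3` (Schanuel at ALL ranks `≤ 2`, open); the rank-`3` tower `(D•z, y_a, y_b)` needs nothing: its storeys have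
`trdeg ≤ 1, ≤ 2, ≤ 2` because the whole field `ℚ(y, eʸ)` has `trdeg ≤ 2`.  CONSEQUENCE: the screens «`iπ ∈ span`», «`log 2 ∈ span`»,
«a coordinate is a Khovanskii single» discharge the `(3, c, y)`-instances of the residuals `BridgeTransverse` (30564) AND
`BridgeTransverseSigma` (26887) STANDALONE — under the Σ-route's `σ`-lower ranks, where `LowerRanks 3` is not available.

## 2. Discharge readings (binder-agnostic, like `RootDecomp1HSubst.cell_clean_of_substExcl`)

* `pin_discharge`      : `H₁ → H₂ → H₃ → CounterEx y → ¬ InTowerHull y → R` for ANY `H₁ H₂ H₃ R` at a pinned `y` (the shape of the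
  `(3,c,y)`-instance of `BridgeTransverse[Sigma]`, whatever the three leading binders are).
* `pair_discharge_σ`   : a `σ`-stable `ℚ`-free PAIR `u` with `trdeg ℚ(u, eᵘ) < 2` contradicts the `σ`-lower-rank binder of rank `3`
  (the inline text `∀ m < 3, ∀ z σ-stable ℚ-free, m ≤ trdeg`): every Σ-instance with that binder then holds outright.
* `dep_discharge`      : a `ℚ`-dependent `y` is no counterexample / satisfies `¬ LinearIndependent ℚ y ∨ _`.

## 3. Pins (explicit depth-one elements)

`depthOne_int_mul_pi_I` (`z = k·πi`) and `depthOne_of_single` (`a z + b eᶻ + c = 0`, `b ≠ 0` rational: `eᶻ ∈ ℚ(z)`), on top of the tree's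
`depthOne_of_isAlgebraic[_exp]` (`RootDecomp1HCurveHull`).
PORT (census-1 gen 8, T15; critic VERDICT 2026-08-30T17:43:22Z): verbatim; §5 (the three ported TWIST31 systems) is split off into `RootDecomp1HPinTwist.lean` for the 400-line lint only.
-/

set_option linter.dupNamespace false

noncomputable section

namespace Summit.Schanuel.Schanuel.Theorems.RootDecomp1HPin

open Complex Set
open Literature.NumberTheory.Transcendental
open Summit.Schanuel.Schanuel.Theorems.RootDecomp1HTowerCells
open Summit.Schanuel.Schanuel.Theorems.RootDecomp1HCurveHull
open Summit.Schanuel.Schanuel.Theorems.RootDecomp1HHull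
open Summit.Schanuel.Schanuel.Theorems.RootDecomp1HClearance

/-! ## 0. Small conversions -/

/-- `trdeg < 3` as `trdeg ≤ 2` (natural-number casts in `Cardinal`). -/
theorem trdeg_le_two_of_lt_three {K : IntermediateField ℚ ℂ} (h : Algebra.trdeg ℚ ↥K < ((3 : ℕ) : Cardinal)) :
    Algebra.trdeg ℚ ↥K ≤ ((2 : ℕ) : Cardinal) := by
  obtain ⟨t, ht⟩ := Cardinal.lt_aleph0.mp (h.trans (Cardinal.natCast_lt_aleph0 (n := 3)))
  rw [ht] at h ⊢
  have htn : t < 3 := by exact_mod_cast h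
  exact_mod_cast (by omega : t ≤ 2)

/-! ## 1. The hull pin at rank three -/

/-- **THE HULL PIN (rank 3, hypothesis-free).**  A rank-`3` counterexample whose span contains a non-zero depth-one element
lies in the tower hull.  (Tower: `(D•z, y_a, y_b)` with `D•z ∈ span_ℤ y`; storeys `≤ 1` (depth one), `≤ 2`, `≤ 2 ≤ 3` because
the prefix fields are subfields of `ℚ(y, eʸ)`, which has `trdeg ≤ 2`.) -/
theorem inTowerHull_of_depthOne_mem_span {y : Fin 3 → ℂ} (hce : CounterEx y) {z : ℂ}
    (hz : z ∈ Submodule.span ℚ (range y)) (hz0 : z ≠ 0)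
    (hd : Algebra.trdeg ℚ ↥(IntermediateField.adjoin ℚ ({z, cexp z} : Set ℂ)) ≤ 1) : InTowerHull y := by
  classical
  -- clear denominators: z' = N • z ∈ span_ℤ y
  obtain ⟨N, hN, hzint⟩ := exists_nsmul_mem_span_int y hz
  set z' : ℂ := (N : ℚ) • z with hz'def
  have hz'0 : z' ≠ 0 := smul_ne_zero (Nat.cast_ne_zero.mpr hN) hz0
  have hd' : Algebra.trdeg ℚ ↥(IntermediateField.adjoin ℚ ({z', cexp z'} : Set ℂ)) ≤ 1 := depthOne_nsmul hd N
  -- integer coefficients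
  obtain ⟨m, hm⟩ := (Submodule.mem_span_range_iff_exists_fun ℤ).1 hzint
  have hmQ : ∑ i, ((m i : ℚ)) • y i = z' := by
    rw [← hm]
    refine Finset.sum_congr rfl fun i _ => ?_
    rw [Int.cast_smul_eq_zsmul]
  -- a non-zero coefficient
  obtain ⟨i₀, hi₀⟩ : ∃ i, m i ≠ 0 := by
    by_contra h
    push Not at h
    apply hz'0
    rw [← hm]
    exact Finset.sum_eq_zero fun i _ => by rw [h i, zero_smul]
  have hmi₀ : ((m i₀ : ℚ)) ≠ 0 := Int.cast_ne_zero.mpr hi₀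
  -- the tower tuple
  let v : Fin 2 → ℂ := y ∘ i₀.succAbove
  let b : Fin 3 → ℂ := Fin.cons (α := fun _ => ℂ) z' v
  have hb0 : b 0 = z' := rfl
  have hbs : ∀ k : Fin 2, b k.succ = y (i₀.succAbove k) := fun k => by
    show Fin.cons (α := fun _ => ℂ) z' v k.succ = _
    rw [Fin.cons_succ]
    rfl
  -- the sum split at i₀
  have hsplit : ((m i₀ : ℚ)) • y i₀ + ∑ k : Fin 2, ((m (i₀.succAbove k) : ℚ)) • y (i₀.succAbove k) = z' := by
    rw [← hmQ, Fin.sum_univ_succAbove _ i₀]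
  have hSv : ∑ k : Fin 2, ((m (i₀.succAbove k) : ℚ)) • y (i₀.succAbove k) ∈ Submodule.span ℚ (range v) :=
    Submodule.sum_mem _ fun k _ => Submodule.smul_mem _ _ (Submodule.subset_span ⟨k, rfl⟩)
  have hyi₀ : y i₀ = ((m i₀ : ℚ))⁻¹ • (z' - ∑ k : Fin 2, ((m (i₀.succAbove k) : ℚ)) • y (i₀.succAbove k)) := by
    rw [← hsplit, add_sub_cancel_right, inv_smul_smul₀ hmi₀]
  -- (i) b is ℚ-free
  have hv : LinearIndependent ℚ v := hce.1.comp _ (Fin.succAbove_right_injective (p := i₀))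
  have hz'v : z' ∉ Submodule.span ℚ (range v) := by
    intro hmem
    have hyin : y i₀ ∈ Submodule.span ℚ (range v) := by
      rw [hyi₀]
      exact Submodule.smul_mem _ _ (Submodule.sub_mem _ hmem hSv)
    have hrange : range v = y '' (range i₀.succAbove) := by
      show range (y ∘ i₀.succAbove) = _
      rw [Set.range_comp]
    have hnot := hce.1.notMem_span_image (s := range i₀.succAbove) (x := i₀)
      (by rintro ⟨k, hk⟩; exact Fin.succAbove_ne i₀ k hk)
    rw [← hrange] at hnot
    exact hnot hyin
  have hbli : LinearIndependent ℚ b := (linearIndependent_finCons).2 ⟨hv, hz'v⟩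
  -- (ii) span b ⊇ y
  have hvb : ∀ k : Fin 2, y (i₀.succAbove k) ∈ Submodule.span ℚ (range b) := fun k =>
    Submodule.subset_span ⟨k.succ, hbs k⟩
  have hz'b : z' ∈ Submodule.span ℚ (range b) := Submodule.subset_span ⟨0, hb0⟩
  have hmem : ∀ j, y j ∈ Submodule.span ℚ (range b) := by
    intro j
    by_cases hj : j = i₀
    · subst hj
      rw [hyi₀]
      exact Submodule.smul_mem _ _ (Submodule.sub_mem _ hz'b
        (Submodule.sum_mem _ fun k _ => Submodule.smul_mem _ _ (hvb k)))
    · obtain ⟨k, hk⟩ := Fin.exists_succAbove_eq hj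
      rw [← hk]
      exact hvb k
  -- (iii) b is a tower tuple
  have hbint : ∀ i, b i ∈ Submodule.span ℤ (range y) := by
    intro i
    refine Fin.cases ?_ (fun k => ?_) i
    · exact hzint
    · rw [hbs k]
      exact Submodule.subset_span ⟨_, rfl⟩
  have htop : Algebra.trdeg ℚ ↥(IntermediateField.adjoin ℚ (range y ∪ range (cexp ∘ y))) ≤ ((2 : ℕ) : Cardinal) :=
    trdeg_le_two_of_lt_three hce.2
  have T1 : TowerTuple ![z'] := towerTuple_of_depthOne fun j => by
    fin_cases j
    simp only [Fin.zero_eta, Matrix.cons_val_zero]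
    exact hd'
  have htow : TowerTuple b := by
    intro k hk
    by_cases hk0 : k = 0
    · subst hk0
      exact trdeg_le_of_depthOne _ fun j => Fin.elim0 j
    by_cases hk1 : k = 1
    · subst hk1
      have heq : b ∘ Fin.castLE hk = ![z'] := by
        funext j
        fin_cases j
        rfl
      exact prefix_trdeg_le_of_eq heq (trdeg_le_of_towerTuple T1)
    · have h2 : ((2 : ℕ) : Cardinal) ≤ (k : Cardinal) := by
        exact_mod_cast (by omega : 2 ≤ k)
      exact ((trdeg_le_of_mem_span_int y (b ∘ Fin.castLE hk) fun i => hbint _).trans htop).trans h2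
  exact ⟨3, b, hbli, htow, hmem⟩

/-- Hence: a rank-`3` counterexample OFF the tower hull has no non-zero depth-one element in its span — WITHOUT `LowerRanks 3`
(compare `RootDecomp1HClearance.not_depthOne_of_mem_span_rank_three`, which assumes it). -/
theorem not_depthOne_of_mem_span_three {y : Fin 3 → ℂ} (hce : CounterEx y) (hnh : ¬ InTowerHull y) {z : ℂ}
    (hz : z ∈ Submodule.span ℚ (range y)) (hz0 : z ≠ 0) :
    ¬ Algebra.trdeg ℚ ↥(IntermediateField.adjoin ℚ ({z, cexp z} : Set ℂ)) ≤ 1 :=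
  fun hd => hnh (inTowerHull_of_depthOne_mem_span hce hz hz0 hd)

/-! ## 2. Discharge readings -/

/-- **PIN DISCHARGE** (binder-agnostic): at a rank-`3` point whose span holds a non-zero depth-one element, every statement of the
shape `H₁ → H₂ → H₃ → CounterEx y → ¬ InTowerHull y → R` holds — this IS the shape of the `(3, c, y)`-instance of `BridgeTransverse`
(30564; binders lower ranks / presented / conj-stable) and of `BridgeTransverseSigma` (26887; `σ`-lower ranks / presented /
`σ`-stable), read through `Iff.rfl`. -/
theorem pin_discharge {y : Fin 3 → ℂ} {z : ℂ} (hz : z ∈ Submodule.span ℚ (range y)) (hz0 : z ≠ 0)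
    (hd : Algebra.trdeg ℚ ↥(IntermediateField.adjoin ℚ ({z, cexp z} : Set ℂ)) ≤ 1) (H₁ H₂ H₃ R : Prop) :
    H₁ → H₂ → H₃ → CounterEx y → ¬ InTowerHull y → R :=
  fun _ _ _ hce hnh => (hnh (inTowerHull_of_depthOne_mem_span hce hz hz0 hd)).elim

/-- **PAIR DISCHARGE (Σ)**: a `σ`-stable `ℚ`-free pair `u` with `trdeg ℚ(u, eᵘ) < 2` contradicts the `σ`-lower-rank binder of rank
`3` (inline text, as in `FinCSSigma` / `BridgeTransverseSigma` at `n = 3`).  The pair need NOT lie in `span y`. -/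
theorem pair_discharge_σ {u : Fin 2 → ℂ} (hu : LinearIndependent ℚ u)
    (hσ : ∀ j, (starRingEnd ℂ) (u j) ∈ Submodule.span ℚ (range u))
    (hlt : Algebra.trdeg ℚ ↥(IntermediateField.adjoin ℚ (range u ∪ range (cexp ∘ u))) < ((2 : ℕ) : Cardinal))
    (hlow : ∀ m < 3, ∀ z : Fin m → ℂ, LinearIndependent ℚ z →
      (∀ j, (starRingEnd ℂ) (z j) ∈ Submodule.span ℚ (range z)) →
      (m : Cardinal) ≤ Algebra.trdeg ℚ ↥(IntermediateField.adjoin ℚ (range z ∪ range (cexp ∘ z)))) : False :=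
  (not_le.2 hlt) (hlow 2 (by norm_num) u hu hσ)

/-- … so every Σ-instance guarded by that binder holds: `(σ-lower ranks 3) → R` for any `R`. -/
theorem pair_discharge_σ_reading {u : Fin 2 → ℂ} (hu : LinearIndependent ℚ u)
    (hσ : ∀ j, (starRingEnd ℂ) (u j) ∈ Submodule.span ℚ (range u))
    (hlt : Algebra.trdeg ℚ ↥(IntermediateField.adjoin ℚ (range u ∪ range (cexp ∘ u))) < ((2 : ℕ) : Cardinal)) (R : Prop) :
    (∀ m < 3, ∀ z : Fin m → ℂ, LinearIndependent ℚ z →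
      (∀ j, (starRingEnd ℂ) (z j) ∈ Submodule.span ℚ (range z)) →
      (m : Cardinal) ≤ Algebra.trdeg ℚ ↥(IntermediateField.adjoin ℚ (range z ∪ range (cexp ∘ z)))) → R :=
  fun hlow => (pair_discharge_σ hu hσ hlt hlow).elim


/-- Purely IMAGINARY tuples are `σ`-stable (`conj (iθ) = -iθ`): the pairs `(iθ₂, iθ₃)` of the classes P4/P5 qualify for
`pair_discharge_σ` as soon as they are `ℚ`-free with `trdeg < 2`. -/
theorem conjStable_of_re_eq_zero {m : ℕ} {u : Fin m → ℂ} (hu : ∀ j, (u j).re = 0) :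
    ∀ j, (starRingEnd ℂ) (u j) ∈ Submodule.span ℚ (range u) := by
  intro j
  have h : (starRingEnd ℂ) (u j) = -(u j) := Complex.ext (by simp [hu j]) (by simp)
  rw [h]
  exact Submodule.neg_mem _ (Submodule.subset_span ⟨j, rfl⟩)

/-- REAL tuples are `σ`-stable (`conj x = x`). -/
theorem conjStable_of_im_eq_zero {m : ℕ} {u : Fin m → ℂ} (hu : ∀ j, (u j).im = 0) :
    ∀ j, (starRingEnd ℂ) (u j) ∈ Submodule.span ℚ (range u) := by
  intro j
  rw [Complex.conj_eq_iff_im.mpr (hu j)]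
  exact Submodule.subset_span ⟨j, rfl⟩

/-- MIXED adapted pairs `(x, iθ)` (`x` real, `θ` real) are `σ`-stable. -/
theorem conjStable_pair_real_imag (x θ : ℝ) :
    ∀ j, (starRingEnd ℂ) (![(x : ℂ), (θ : ℂ) * I] j) ∈ Submodule.span ℚ (range ![(x : ℂ), (θ : ℂ) * I]) := by
  intro j
  fin_cases j
  · have h : (starRingEnd ℂ) (x : ℂ) = (x : ℂ) := Complex.conj_ofReal x
    simp only [Fin.zero_eta, Matrix.cons_val_zero]
    rw [h]
    exact Submodule.subset_span ⟨0, rfl⟩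
  · have h : (starRingEnd ℂ) ((θ : ℂ) * I) = -((θ : ℂ) * I) := by
      rw [map_mul, Complex.conj_ofReal, Complex.conj_I]; ring
    simp only [Fin.mk_one, Matrix.cons_val_one, Matrix.cons_val_zero]
    rw [h]
    exact Submodule.neg_mem _ (Submodule.subset_span ⟨1, rfl⟩)

/-- **PAIR DISCHARGE (1H)**: the same against the full lower-rank binder `∀ m < 3, SchanuelRank m` of `FinCS` / `BridgeTransverse`. -/
theorem pair_discharge {u : Fin 2 → ℂ} (hu : LinearIndependent ℚ u)
    (hlt : Algebra.trdeg ℚ ↥(IntermediateField.adjoin ℚ (range u ∪ range (cexp ∘ u))) < ((2 : ℕ) : Cardinal))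
    (hlow : LowerRanks 3) : False :=
  (not_le.2 hlt) (hlow 2 (by norm_num) u hu)

/-- **DEPENDENT DISCHARGE**: a `ℚ`-dependent tuple is not a counterexample … -/
theorem dep_discharge {n : ℕ} {y : Fin n → ℂ} (hdep : ¬ LinearIndependent ℚ y) : ¬ CounterEx y := fun h => hdep h.1

/-- … and satisfies the instrument's disjunction `¬ LinearIndependent ℚ y ∨ R` for any `R`. -/
theorem dep_discharge_or {n : ℕ} {y : Fin n → ℂ} (hdep : ¬ LinearIndependent ℚ y) (R : Prop) :
    ¬ LinearIndependent ℚ y ∨ R := Or.inl hdep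

/-! ## 3. Pins: explicit depth-one elements -/

/-! (`depthOne_of_isAlgebraic`, `depthOne_of_isAlgebraic_exp` — `RootDecomp1HCurveHull`; `depthOne_nsmul` — `RootDecomp1HTowerCells`;
`mem_towerHullSet_of_depthOne` — `RootDecomp1HCurveHullMerge` are already in the tree and are used as such.) -/

/-- **THE `iπ`-PIN**: `z = k·π·i` (`k : ℤ`) is depth one (`eᶻ = (-1)^k`). -/
theorem depthOne_int_mul_pi_I (k : ℤ) :
    Algebra.trdeg ℚ ↥(IntermediateField.adjoin ℚ ({((k : ℂ) * (Real.pi * I)), cexp ((k : ℂ) * (Real.pi * I))} : Set ℂ)) ≤ 1 := by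
  apply depthOne_of_isAlgebraic_exp
  have h : cexp ((k : ℂ) * (Real.pi * I)) = algebraMap ℚ ℂ ((-1 : ℚ) ^ k) := by
    rw [Complex.exp_int_mul, Complex.exp_pi_mul_I]
    push_cast
    rfl
  rw [h]
  exact isAlgebraic_algebraMap _

/-- **THE KHOVANSKII-SINGLE PIN**: a coordinate relation `a z + b eᶻ + c = 0` with `b ≠ 0` (`a b c : ℚ`) makes `z` depth one
(`eᶻ = -(a z + c)/b ∈ ℚ(z)`).  (For `b = 0`, `a ≠ 0` the point `z = -c/a` is rational: `depthOne_of_isAlgebraic`.) -/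
theorem depthOne_of_single {z : ℂ} {a b c : ℚ} (hb : b ≠ 0) (h : (a : ℂ) * z + (b : ℂ) * cexp z + (c : ℂ) = 0) :
    Algebra.trdeg ℚ ↥(IntermediateField.adjoin ℚ ({z, cexp z} : Set ℂ)) ≤ 1 := by
  have hz : z ∈ IntermediateField.adjoin ℚ ({z} : Set ℂ) := IntermediateField.subset_adjoin ℚ _ rfl
  have hexp : cexp z = -((a : ℂ) * z + (c : ℂ)) / (b : ℂ) := by
    have hb' : (b : ℂ) ≠ 0 := by exact_mod_cast hb
    field_simp
    linear_combination h
  have hmem : cexp z ∈ IntermediateField.adjoin ℚ ({z} : Set ℂ) := by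
    rw [hexp]
    refine div_mem (neg_mem (add_mem (mul_mem ?_ hz) ?_)) ?_
    · exact_mod_cast (IntermediateField.adjoin ℚ ({z} : Set ℂ)).algebraMap_mem a
    · exact_mod_cast (IntermediateField.adjoin ℚ ({z} : Set ℂ)).algebraMap_mem c
    · exact_mod_cast (IntermediateField.adjoin ℚ ({z} : Set ℂ)).algebraMap_mem b
  have hle : IntermediateField.adjoin ℚ ({z, cexp z} : Set ℂ) ≤ IntermediateField.adjoin ℚ ({z} : Set ℂ) :=
    IntermediateField.adjoin_le_iff.mpr (Set.insert_subset_iff.mpr ⟨hz, Set.singleton_subset_iff.mpr hmem⟩)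
  exact (OneMotiveToric.trdeg_mono hle).trans (trdeg_adjoin_le_one_of_subsingleton Set.subsingleton_singleton)

/-! ## 4. PINNING FORMS ⇒ the bridge instances are VACUOUS (system-level, hypothesis-free, both routes)

A presented size-1 system `Φ` (or an exact `ℚ`-combination of its rows — the census' screen S4) that contains one of the following
PINNING FORMS has ALL its rank-3 bridge instances (`BridgeTransverse` 30564 / `BridgeTransverseSigma` 26887 at `n = 3`) vacuous, with NO
lower-rank binder: at every zero `y`, either `y` is `ℚ`-dependent or `span_ℚ y` holds a non-zero depth-one element (then `InTowerHull y`
at any counterexample, § 1).  The TWIST31 / REACH31 hull screens are instances: S1 `t/π ∈ ℚ` and the exponential binomials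
`e^{y_i} ∓ e^{y_j}` (`expEq`, `expNeg`), S2 `1 ∈ span` (`linConst`), S3 `log q ∈ span` (`expConst`), S4 single-pair row (`single`). -/

/-- `z = k·πi` is depth one (transport of `depthOne_int_mul_pi_I`). -/
theorem depthOne_of_eq_int_mul_pi_I {z : ℂ} (k : ℤ) (h : z = (k : ℂ) * (Real.pi * I)) :
    Algebra.trdeg ℚ ↥(IntermediateField.adjoin ℚ ({z, cexp z} : Set ℂ)) ≤ 1 := by
  subst h
  exact depthOne_int_mul_pi_I k

/-- **exp-binomial `e^{y_i} = e^{y_j}`** (`i ≠ j`): `y_i − y_j ∈ 2πiℤ`; either `y_i = y_j` (`ℚ`-dependent) or `2πik ∈ span`, `k ≠ 0` (pinned). -/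
theorem bridge_vacuous_of_expEq {y : Fin 3 → ℂ} {i j : Fin 3} (hij : i ≠ j) (h : cexp (y i) = cexp (y j))
    (H₁ H₂ H₃ R : Prop) : H₁ → H₂ → H₃ → CounterEx y → ¬ InTowerHull y → R := by
  intro _ _ _ hce hnh
  obtain ⟨n, hn⟩ := Complex.exp_eq_exp_iff_exists_int.mp h
  by_cases hn0 : n = 0
  · subst hn0
    have hyij : y i = y j := by rw [hn]; push_cast; ring
    exact absurd (hce.1.injective hyij) hij
  · have hz : y i - y j ∈ Submodule.span ℚ (range y) :=
      Submodule.sub_mem _ (Submodule.subset_span ⟨i, rfl⟩) (Submodule.subset_span ⟨j, rfl⟩)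
    have hzeq : y i - y j = ((2 * n : ℤ) : ℂ) * (Real.pi * I) := by rw [hn]; push_cast; ring
    have hz0 : y i - y j ≠ 0 := by
      rw [hzeq]
      have hπ : (Real.pi : ℂ) ≠ 0 := Complex.ofReal_ne_zero.mpr Real.pi_ne_zero
      have h2n : ((2 * n : ℤ) : ℂ) ≠ 0 := by exact_mod_cast (by omega : 2 * n ≠ 0)
      exact mul_ne_zero h2n (mul_ne_zero hπ Complex.I_ne_zero)
    exact (hnh (inTowerHull_of_depthOne_mem_span hce hz hz0 (depthOne_of_eq_int_mul_pi_I (2 * n) hzeq))).elim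

/-- **exp-binomial `e^{y_i} = −e^{y_j}`**: `y_i − y_j ∈ (2ℤ+1)πi` is a non-zero element of `iπℚ` in the span (pinned). -/
theorem bridge_vacuous_of_expNeg {y : Fin 3 → ℂ} {i j : Fin 3} (h : cexp (y i) = -cexp (y j))
    (H₁ H₂ H₃ R : Prop) : H₁ → H₂ → H₃ → CounterEx y → ¬ InTowerHull y → R := by
  intro _ _ _ hce hnh
  have h' : cexp (y i) = cexp (y j + Real.pi * I) := by
    rw [Complex.exp_add, Complex.exp_pi_mul_I]; rw [h]; ring
  obtain ⟨n, hn⟩ := Complex.exp_eq_exp_iff_exists_int.mp h'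
  have hz : y i - y j ∈ Submodule.span ℚ (range y) :=
    Submodule.sub_mem _ (Submodule.subset_span ⟨i, rfl⟩) (Submodule.subset_span ⟨j, rfl⟩)
  have hzeq : y i - y j = ((2 * n + 1 : ℤ) : ℂ) * (Real.pi * I) := by rw [hn]; push_cast; ring
  have hz0 : y i - y j ≠ 0 := by
    rw [hzeq]
    have hπ : (Real.pi : ℂ) ≠ 0 := Complex.ofReal_ne_zero.mpr Real.pi_ne_zero
    have h2n : ((2 * n + 1 : ℤ) : ℂ) ≠ 0 := by exact_mod_cast (by omega : 2 * n + 1 ≠ 0)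
    exact mul_ne_zero h2n (mul_ne_zero hπ Complex.I_ne_zero)
  exact (hnh (inTowerHull_of_depthOne_mem_span hce hz hz0 (depthOne_of_eq_int_mul_pi_I (2 * n + 1) hzeq))).elim

/-- **single-pair row** (S4): a rational row `a y_j + b e^{y_j} + c = 0` with `b ≠ 0` vanishing at `y` pins `y_j` (Khovanskii single;
`y_j ≠ 0` by `ℚ`-freeness). -/
theorem bridge_vacuous_of_single {y : Fin 3 → ℂ} {j : Fin 3} {a b c : ℚ} (hb : b ≠ 0)
    (h : (a : ℂ) * y j + (b : ℂ) * cexp (y j) + (c : ℂ) = 0)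
    (H₁ H₂ H₃ R : Prop) : H₁ → H₂ → H₃ → CounterEx y → ¬ InTowerHull y → R := by
  intro _ _ _ hce hnh
  exact (hnh (inTowerHull_of_depthOne_mem_span hce (Submodule.subset_span ⟨j, rfl⟩) (hce.1.ne_zero j)
    (depthOne_of_single hb h))).elim

/-- **single-pair row, `b = 0`**: `a y_j + c = 0`, `a ≠ 0` makes `y_j` rational: `y_j = 0` is excluded by `ℚ`-freeness, so `y_j` is a
non-zero algebraic element of the span (pinned). -/
theorem bridge_vacuous_of_ratCoord {y : Fin 3 → ℂ} {j : Fin 3} {a c : ℚ} (ha : a ≠ 0)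
    (h : (a : ℂ) * y j + (c : ℂ) = 0)
    (H₁ H₂ H₃ R : Prop) : H₁ → H₂ → H₃ → CounterEx y → ¬ InTowerHull y → R := by
  intro _ _ _ hce hnh
  have hyj : y j = algebraMap ℚ ℂ (-c / a) := by
    have ha' : (a : ℂ) ≠ 0 := by exact_mod_cast ha
    rw [show (algebraMap ℚ ℂ (-c / a)) = ((-c / a : ℚ) : ℂ) from rfl]
    push_cast
    field_simp
    linear_combination h
  have halg : IsAlgebraic ℚ (y j) := by rw [hyj]; exact isAlgebraic_algebraMap _
  exact (hnh (inTowerHull_of_depthOne_mem_span hce (Submodule.subset_span ⟨j, rfl⟩) (hce.1.ne_zero j)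
    (depthOne_of_isAlgebraic halg))).elim

/-- **linear row with constant** (S2 «`1 ∈ span`»): `∑ aᵢ yᵢ = q` with `q ≠ 0` rational puts the non-zero algebraic number `q` in the span. -/
theorem bridge_vacuous_of_linConst {y : Fin 3 → ℂ} (a : Fin 3 → ℚ) {q : ℚ} (hq : q ≠ 0)
    (h : ∑ i, (a i : ℂ) * y i = (q : ℂ))
    (H₁ H₂ H₃ R : Prop) : H₁ → H₂ → H₃ → CounterEx y → ¬ InTowerHull y → R := by
  intro _ _ _ hce hnh
  have hz : (q : ℂ) ∈ Submodule.span ℚ (range y) := by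
    rw [← h]
    refine Submodule.sum_mem _ fun i _ => ?_
    have : (a i : ℂ) * y i = (a i) • y i := by rw [Rat.smul_def]
    rw [this]
    exact Submodule.smul_mem _ _ (Submodule.subset_span ⟨i, rfl⟩)
  have hq0 : (q : ℂ) ≠ 0 := by exact_mod_cast hq
  have halg : IsAlgebraic ℚ (q : ℂ) := isAlgebraic_algebraMap q
  exact (hnh (inTowerHull_of_depthOne_mem_span hce hz hq0 (depthOne_of_isAlgebraic halg))).elim

/-- **exponential with rational value** (S3 «`log q ∈ span`», read on the coordinate: `b e^{y_j} + c = 0`, `b ≠ 0`): `e^{y_j}` is rational,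
so `y_j` (non-zero by `ℚ`-freeness) is a depth-one element of the span. -/
theorem bridge_vacuous_of_expConst {y : Fin 3 → ℂ} {j : Fin 3} {b c : ℚ} (hb : b ≠ 0)
    (h : (b : ℂ) * cexp (y j) + (c : ℂ) = 0)
    (H₁ H₂ H₃ R : Prop) : H₁ → H₂ → H₃ → CounterEx y → ¬ InTowerHull y → R :=
  bridge_vacuous_of_single (a := 0) hb (by simpa using h) H₁ H₂ H₃ R

/-- **general exact pin** (the census' S1/S3 certificates as data): any exact rational combination `z = ∑ aᵢ yᵢ` which is a NON-ZERO
integer multiple of `πi`, or has `e^z` rational/algebraic, or is itself algebraic, makes the bridge instance vacuous. -/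
theorem bridge_vacuous_of_combination {y : Fin 3 → ℂ} (a : Fin 3 → ℚ) (hz0 : ∑ i, (a i : ℂ) * y i ≠ 0)
    (hd : Algebra.trdeg ℚ ↥(IntermediateField.adjoin ℚ ({∑ i, (a i : ℂ) * y i, cexp (∑ i, (a i : ℂ) * y i)} : Set ℂ)) ≤ 1)
    (H₁ H₂ H₃ R : Prop) : H₁ → H₂ → H₃ → CounterEx y → ¬ InTowerHull y → R := by
  intro _ _ _ hce hnh
  have hz : ∑ i, (a i : ℂ) * y i ∈ Submodule.span ℚ (range y) := by
    refine Submodule.sum_mem _ fun i _ => ?_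
    have : (a i : ℂ) * y i = (a i) • y i := by rw [Rat.smul_def]
    rw [this]
    exact Submodule.smul_mem _ _ (Submodule.subset_span ⟨i, rfl⟩)
  exact (hnh (inTowerHull_of_depthOne_mem_span hce hz hz0 hd)).elim

end Summit.Schanuel.Schanuel.Theorems.RootDecomp1HPin
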